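import Summits.CriticalPhenomena.SAWScalingLimit.Theorems.SAWLeftRightFKGFKGToTraversalBoundEventualShellReduction
import Summits.CriticalPhenomena.SAWScalingLimit.Theorems.SAWLeftRightFKGFKGToTraversalBoundSlitNecklaceDefs
import Summits.CriticalPhenomena.SAWScalingLimit.Theorems.SAWLeftRightFKGFKGToTraversalBoundGermTightBdry
import Summits.CriticalPhenomena.SAWScalingLimit.Theses.SAWTotalPositivity
import HarnessLib

/-!
# Crux `FKGToTraversalBound` (stmt-CriticalPhenomena-1878) — the ROUTE-LEVEL SPLIT into four sub-cruxes

Route `route-CriticalPhenomena-SAWLeftRightFKG`, crux decl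
`Summit.CriticalPhenomena.SAWScalingLimit.Theses.SAWLeftRightFKG.FKGToTraversalBound`
(`LeftRightFKG → SAWTraversalBound`, `Negative.iff_imp`).  Crux-strategist decomposition
(planner-cstrat-stmt-CriticalPhenomena-1878-s1-0, 2026-08-17), asked for by leads c1, c3, a1, a2, c4, c5
("file the engine ONCE with the bubble as explicit dependency; file GermTight as a shared item; make
'blocked on stmt-7117' machine-readable at route level").

The four sub-cruxes (the route children of `FKGToTraversalBound`; here they appear only INLINE, def-free,
as the four hypotheses of the registered glue `FKGToTraversalBound_of_subs`, in this order):

1. **bubble** — VERBATIM the shared item stmt-CriticalPhenomena-7117 (`SAWTotalPositivity.CriticalBubbleBound`):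
   one `C < ∞` bounds `Z_Ω(u,v)` for all bounded `Ω`, `δ > 0`, lattice-adjacent `u ∼ v`.
2. **engine** — `LeftRightFKG → bubble → UniformSubshellTight`: left–right PA plus the bubble give UNIFORM
   sub-shell tightness of the traversal counts over the whole r2 family (carrier `{z | wind(δ-polyline of C, z)
   ≠ 0}` = the `let Ω` of `LeftRightFKG` = `Negative.dom C δ`; robust static allowance on the concentric
   sub-shell).  VERBATIM the registered stub `stub_engine` of line `slit-necklace`; its interior is the sibling
   line `gates-by-bubble-doors-by-fkg` (landed `stub_gateExcision`; open `stub_wideDoorSeed`,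
   `stub_collarAssembly`, and a uniform-over-r2 lattice Kemppainen–Smirnov iteration).  The ONE place the route's
   thesis (left–right PA) is consumed.
3. **germ** — germ tightness at BOTH marked points, VERBATIM the registered stub `stub_germTight`
   (`GermTight D a b a ∧ GermTight D a b b` for every endpoint approximation): rate-free, PA-free; a THEOREM on
   the R1 class (`germTight_of_bdryApprox`, p128312).
4. **necklace reduction** — `UniformSubshellTight → ∀ D a b, IsEndpointApprox D a b → GermTight a → GermTight b →
   EventualShellTight D a b`: the static necklace reduction (tame domains: line `slit-necklace`, closed modulo the
   planar lemma `stub_necklaceWitnessFarU`; wild Jordan domains: the residue `stub_wildDomains`).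

The glue `FKGToTraversalBound_of_subs : bubble → engine → germ → necklace → FKGToTraversalBound` is PROVED from
the LANDED last arrow `SlitNecklace.stub_eventualShellReduction` (p127535: per-shell eventual tightness ⇒ (H1)
for one approximation, `K = 8`, `λ = 3`).  The `example`s after it feed NAMED-currency hypotheses to the inline
glue, certifying that each inline child is definitionally the named statement (`CriticalBubbleBound`,
`stub_engine`'s type, `stub_germTight`'s type, the necklace reduction over `UniformSubshellTight` / `GermTight` /
`EventualShellTight`).  No `sorry`, no Prop definitions, no named literature fact; axioms are the standard three.
-/

noncomputable section

open MeasureTheory Filter Topology Set Metric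
open scoped NNReal ENNReal
open Literature.Probability.LatticeModels
open Literature.Probability.RandomPlanarGeometry
open Literature.Probability.RandomPlanarGeometry.SAW
open Summit.CriticalPhenomena.SAWScalingLimit.Theses.SAWLeftRightFKG
open Summit.CriticalPhenomena.SAWScalingLimit.Theses.SAWTotalPositivity (CriticalBubbleBound)
open Summit.CriticalPhenomena.SAWScalingLimit.Theorems.FKGToTraversalBound.Negative (dom H1At BdryApprox)
open Summit.CriticalPhenomena.SAWScalingLimit.Theorems.FKGToTraversalBound.SlitNecklace

namespace Summit.CriticalPhenomena.SAWScalingLimit.Theorems.FKGToTraversalBound.Split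

/-! ## The glue (registered stub; `--glue-by` target of the route split) -/

/-- **Registered stub `FKGToTraversalBound_of_subs`** — the split of `FKGToTraversalBound` is sound: bubble →
engine → germ tightness → necklace reduction → the crux, the four hypotheses written INLINE exactly as the route
children (`CriticalBubbleBound`, `BubbleFKGEngine`, `GermTightness`, `NecklaceReduction`).  Proof: PA and the
bubble feed the engine; its uniform output and the two germs feed the necklace reduction, giving per-shell
eventual tightness; the landed `stub_eventualShellReduction` turns that into (H1) for the approximation at hand.
[folklore] -/
theorem FKGToTraversalBound_of_subs : (∃ C : ENNReal, C ≠ ⊤ ∧ ∀ (Ω : Set ℂ) (δ : ℝ) (u v : Site 2), Bornology.IsBounded Ω → 0 < δ → (zdGraph 2).Adj u v → weight Ω δ u v Set.univ ≤ C) → (LeftRightFKG → (∃ C : ENNReal, C ≠ ⊤ ∧ ∀ (Ω : Set ℂ) (δ : ℝ) (u v : Site 2), Bornology.IsBounded Ω → 0 < δ → (zdGraph 2).Adj u v → weight Ω δ u v Set.univ ≤ C) → ∀ ε : ℝ, 0 < ε → ∀ n₀ : ℕ, ∃ n : ℕ, ∀ (δ : ℝ) (c u v u' v' : Site 2) (C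 : (zdGraph 2).Walk c c), let Ω : Set ℂ := {z | Literature.Topology.PlaneTopology.wind (fun t : ℝ => Set.IccExtend zero_le_one (C.toCurve (meshPoint δ)) t - z) ≠ 0}; 0 < δ → u' ∈ C.support → v' ∈ C.support → (zdGraph 2).Adj u u' → (zdGraph 2).Adj v v' → ∀ (x : ℂ) (ρ R : ℝ), δ ≤ ρ → 2 * ρ ≤ R → (∃ γ₀ : DomainSAW Ω δ u v, ¬ (⟨γ₀.walk.toCurve (meshPoint δ)⟩ : Curve ℂ).HasTraversals (n₀ + 1) x ((3 * ρ + R) / 4) ((ρ + 3 * R) / 4)) → law Ω δ u v {γ | (⟨γ.walk.toCurve (meshPoint δ)⟩ : Curve ℂ).HasTraversals n x ρ R} ≤ ENNReal.ofReal ε) → (∀ (D : DobrushinDomain) (a b : ℝ → Site 2), IsEndpointApprox D a b → (∀ r : ℝ, 0 < r → ∀ ε : ℝ, 0 < ε → ∃ n : ℕ, ∀ᶠ δ in nhdsWithin (0 : ℝ) (Set.Ioi 0), law D.carrier δ (a δ) (b δ) {γ | (⟨γ.walk.toCurve (meshPoint δ)⟩ : Curve ℂ).HasTraversals n (meshPoint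 δ (a δ)) (2 * infDist (meshPoint δ (a δ)) D.carrierᶜ + 4 * δ) r} ≤ ENNReal.ofReal ε) ∧ (∀ r : ℝ, 0 < r → ∀ ε : ℝ, 0 < ε → ∃ n : ℕ, ∀ᶠ δ in nhdsWithin (0 : ℝ) (Set.Ioi 0), law D.carrier δ (a δ) (b δ) {γ | (⟨γ.walk.toCurve (meshPoint δ)⟩ : Curve ℂ).HasTraversals n (meshPoint δ (b δ)) (2 * infDist (meshPoint δ (b δ)) D.carrierᶜ + 4 * δ) r} ≤ ENNReal.ofReal ε)) → ((∀ ε : ℝ, 0 < ε → ∀ n₀ : ℕ, ∃ n : ℕ, ∀ (δ : ℝ) (c u v u' v' : Site 2) (C : (zdGraph 2).Walk c c), let Ω : Set ℂ := {z | Literature.Topology.PlaneTopology.wind (fun t : ℝ => Set.IccExtend zero_le_one (C.toCurve (meshPoint δ)) t - z) ≠ 0}; 0 < δ → u' ∈ C.support → v' ∈ C.support → (zdGraph 2).Adj u u' → (zdGraph 2).Adj v v' → ∀ (x : ℂ) (ρ R : ℝ), δ ≤ ρ → 2 * ρ ≤ R → (∃ γ₀ : DomainSAW Ω δ u v, ¬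 (⟨γ₀.walk.toCurve (meshPoint δ)⟩ : Curve ℂ).HasTraversals (n₀ + 1) x ((3 * ρ + R) / 4) ((ρ + 3 * R) / 4)) → law Ω δ u v {γ | (⟨γ.walk.toCurve (meshPoint δ)⟩ : Curve ℂ).HasTraversals n x ρ R} ≤ ENNReal.ofReal ε) → ∀ (D : DobrushinDomain) (a b : ℝ → Site 2), IsEndpointApprox D a b → (∀ r : ℝ, 0 < r → ∀ ε : ℝ, 0 < ε → ∃ n : ℕ, ∀ᶠ δ in nhdsWithin (0 : ℝ) (Set.Ioi 0), law D.carrier δ (a δ) (b δ) {γ | (⟨γ.walk.toCurve (meshPoint δ)⟩ : Curve ℂ).HasTraversals n (meshPoint δ (a δ)) (2 * infDist (meshPoint δ (a δ)) D.carrierᶜ + 4 * δ) r} ≤ ENNReal.ofReal ε) → (∀ r : ℝ, 0 < r → ∀ ε : ℝ, 0 < ε → ∃ n : ℕ, ∀ᶠ δ in nhdsWithin (0 : ℝ) (Set.Ioi 0), law D.carrier δ (a δ) (b δ) {γ | (⟨γ.walk.toCurve (meshPoint δ)⟩ : Curve ℂ).HasTraversals n (meshPoint δ (b δ)) (2 *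 infDist (meshPoint δ (b δ)) D.carrierᶜ + 4 * δ) r} ≤ ENNReal.ofReal ε) → ∀ (x : ℂ) (ρ R : ℝ), 0 < ρ → 2 * ρ ≤ R → R ≤ 1 → ∀ ε : ℝ, 0 < ε → ∃ n : ℕ, ∀ᶠ δ in nhdsWithin (0 : ℝ) (Set.Ioi 0), law D.carrier δ (a δ) (b δ) {γ | (⟨γ.walk.toCurve (meshPoint δ)⟩ : Curve ℂ).HasTraversals n x ρ R} ≤ ENNReal.ofReal ε) → FKGToTraversalBound :=
  fun hB hE hG hN hPA D a b hab =>
    stub_eventualShellReduction D a b hab (hN (hE hPA hB) D a b hab (hG D a b hab).1 (hG D a b hab).2)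

/-! ## Certificate: the inline children ARE the line's named currencies

The `example`s below feed NAMED-currency hypotheses to the inline glue above (and state the R1 remark); they
elaborate only because each inline child is definitionally the named statement: child 1 ≡ `CriticalBubbleBound`
(stmt-7117), child 2 ≡ `LeftRightFKG → CriticalBubbleBound → UniformSubshellTight` (registered `stub_engine`),
child 3 ≡ germ tightness at both marked points (registered `stub_germTight`), child 4 ≡ the necklace reduction
over `UniformSubshellTight` / `GermTight` / `EventualShellTight`.  (Kept as `example`s so that the file declares
exactly one theorem, the registered glue.) -/

/-- The crux from the four NAMED currencies, through the inline glue (definitional identity of the route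
children with the line's vocabulary, kernel-checked). -/
example (hB : CriticalBubbleBound)
    (hE : LeftRightFKG → CriticalBubbleBound → UniformSubshellTight)
    (hG : ∀ (D : DobrushinDomain) (a b : ℝ → Site 2), IsEndpointApprox D a b →
      GermTight D a b a ∧ GermTight D a b b)
    (hN : UniformSubshellTight → ∀ (D : DobrushinDomain) (a b : ℝ → Site 2), IsEndpointApprox D a b →
      GermTight D a b a → GermTight D a b b → EventualShellTight D a b) :
    FKGToTraversalBound :=
  FKGToTraversalBound_of_subs hB hE hG hN

/-- Child 1 is stmt-CriticalPhenomena-7117 verbatim. -/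
example : (∃ C : ENNReal, C ≠ ⊤ ∧ ∀ (Ω : Set ℂ) (δ : ℝ) (u v : Site 2), Bornology.IsBounded Ω → 0 < δ →
    (zdGraph 2).Adj u v → weight Ω δ u v Set.univ ≤ C) ↔ CriticalBubbleBound :=
  Iff.rfl

/-- On the R1 class (`Negative.BdryApprox`) the germ child is ALREADY A THEOREM (`germTight_of_bdryApprox`,
p128312): there (H1) for the approximation needs only bubble, engine and necklace reduction.  Off R1 the deep
fragment is inhabited (`Negative.exists_isEndpointApprox_not_bdryApprox`, p82017) — the regime isolated in
children 3–4. -/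
example (hB : CriticalBubbleBound)
    (hE : LeftRightFKG → CriticalBubbleBound → UniformSubshellTight)
    (hN : UniformSubshellTight → ∀ (D : DobrushinDomain) (a b : ℝ → Site 2), IsEndpointApprox D a b →
      GermTight D a b a → GermTight D a b b → EventualShellTight D a b)
    (hPA : LeftRightFKG) (D : DobrushinDomain) (a b : ℝ → Site 2) (hab : IsEndpointApprox D a b)
    (hbd : BdryApprox D a b) : H1At D a b :=
  stub_eventualShellReduction D a b hab
    (hN (hE hPA hB) D a b hab (germTight_of_bdryApprox D a b hab hbd).1
      (germTight_of_bdryApprox D a b hab hbd).2)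

example : ∃ a b : ℝ → Site 2, IsEndpointApprox DobrushinDomain.unitDisc a b ∧
    ¬ BdryApprox DobrushinDomain.unitDisc a b :=
  Negative.exists_isEndpointApprox_not_bdryApprox

end Summit.CriticalPhenomena.SAWScalingLimit.Theorems.FKGToTraversalBound.Split

end
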